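import Summits.RiemannHypothesis.RiemannHypothesis.Theorems.SemilocalNegCertEleven
import Summits.RiemannHypothesis.RiemannHypothesis.Theorems.SemilocalLogAtomsB
import Summits.RiemannHypothesis.RiemannHypothesis.Theorems.SemilocalLogAtomsC
import Summits.RiemannHypothesis.RiemannHypothesis.Theorems.SemilocalLogAtomsD
import Summits.RiemannHypothesis.RiemannHypothesis.Theorems.SemilocalLogAtomsE
import Summits.RiemannHypothesis.RiemannHypothesis.Theorems.SemilocalNegCertWide
import HarnessLib

/-!
# Semi-local threshold of the `{∞} ∪ {p < 53}` form, negative side: `a*({2,…,47}) ≤ 257/128` (the wall `q = 53`)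

Cell `rh-explicit` (HOME `run/shared/lean/pub/rh-explicit/`), seat cc-s2-4 gen8 (A4-EXT item (1): theorem upper ends for the walls
`q = 53 … 73`; `S = S_53 = {2, 3, 5, 7, 11, 13, 17, 19, 23, 29, 31, 37, 41, 43, 47}`, class `2, …, 47 ∈ S ∌ 53`).  Honest framing: theorems about the tree's
`weilSemilocalThreshold S`; nothing here bears on RH.  No data is trusted: 13 kernel facts (`decide +kernel`) of the
WIDE piecewise certificate (`SemilocalNegCertWide.lean`: scope `b ≤ 4`, majorant `archMajorWL 10 4 5 u₀`, no polar credit),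
`certUptoFortySeven` (window `2b = 257 / 64`, bulk in 11 pieces).

Instance data: window `N = 55` (`2b < log 56`), atoms = the `S`-smooth prime powers `≤ 55`:
`2, 3, 4, 5, 7, 8, 9, 11, 13, 16, 17, 19, 23, 25, 27, 29, 31, 32, 37, 41, 43, 47, 49` (enclosures `SemilocalLogAtoms{,B,C,D,E}.lean`).  Witness: bottom vector of the odd Legendre
section `d = 13` at `b = 257/128` from this seat's exact-kappa finder (`polyfind.py`, HOME/cc-s2-4/gen7/): `Re Q_S(G)/‖G‖² =
−2.8570·10⁻⁴ (form without the polar credit)` ⇒ **`weilSemilocalThreshold {2, 3, 5, 7, 11, 13, 17, 19, 23, 29, 31, 37, 41, 43, 47} ≤ 257/128`**.  The window sits just beyond the KNEE of the wall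
(`b ≈ a*(S_53) + 0.01`: past it the finite-degree sections turn strongly negative and degree 13 suffices; closer to `a*`
the same witness class needs degree ≥ 25 — gen7, CC4-LEAN §12.5; knee table CC4-LEAN §13).  Locality (`N = 55`): **`a*(S) = a*(S_53) ∈
[0.8046, 257/128]` for every finite `S ⊇ S_53` with `53 ∉ S`** (DATA: a*(S_53) ∈ (1.985181, 1.985188] (cc6, N = 400)).  Folklore throughout.
-/

set_option autoImplicit false
set_option linter.dupNamespace false  -- the mandated namespace repeats `RiemannHypothesis`

noncomputable section

open Complex Filter Set MeasureTheory Topology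
open scoped Real

namespace Summit.RiemannHypothesis.RiemannHypothesis.Theorems.SemilocalPolyWitness

open MeasureTheory Set Finset Real
open Literature.NumberTheory.LFunctions
open Summit.RiemannHypothesis.RiemannHypothesis.Theorems.MotivicDoor
open Summit.RiemannHypothesis.RiemannHypothesis.Theorems.MotivicDoor.SemilocalThreshold
open Summit.RiemannHypothesis.RiemannHypothesis.Theorems.MotivicDoor.SemilocalMarkov
open LQ


/-! ### The atom table of the `{2, 3, 5, 7, 11, 13, 17, 19, 23, 29, 31, 37, 41, 43, 47}`-form on windows `b < (log 56)/2` (`N = 55`) -/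

/-- The atoms of the `{2, 3, 5, 7, 11, 13, 17, 19, 23, 29, 31, 37, 41, 43, 47}`-form below `(log 56)/2`: `2, 3, 4, 5, 7, 8, 9, 11, 13, 16, 17, 19, 23, 25, 27, 29, 31, 32, 37, 41, 43, 47, 49`. -/
def atomsUptoFortySeven : List (ℕ × AtomQ) := [atomTwo, atomThree, atomFour, atomFive, atomSeven, atomEight, atomNine, atomEleven, atomThirteen, atomSixteen, atomSeventeen, atomNineteen, atomTwentyThree, atomTwentyFive, atomTwentySeven, atomTwentyNine, atomThirtyOne, atomThirtyTwo, atomThirtySeven, atomFortyOne, atomFortyThree, atomFortySeven, atomFortyNine]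

/-- A rational lower bound of `log 56`. -/
def logSuccLoUptoFortySeven : ℚ := 3 * logTwoLo20 + logSevenLo

/-- **The atom table encloses `({2, 3, 5, 7, 11, 13, 17, 19, 23, 29, 31, 37, 41, 43, 47}, 55)`.** -/
theorem atomsEnclose_UptoFortySeven : AtomsEnclose {2, 3, 5, 7, 11, 13, 17, 19, 23, 29, 31, 37, 41, 43, 47} 55 atomsUptoFortySeven logSuccLoUptoFortySeven where
  nodup := by decide
  lt_succ := by decide
  cover := by
    intro n hn hnot
    simp only [atomsUptoFortySeven, atomTwo, atomThree, atomFour, atomFive, atomSeven, atomEight, atomNine, atomEleven, atomThirteen, atomSixteen, atomSeventeen, atomNineteen, atomTwentyThree, atomTwentyFive, atomTwentySeven, atomTwentyNine, atomThirtyOne, atomThirtyTwo, atomThirtySeven, atomFortyOne, atomFortyThree, atomFortySeven, atomFortyNine, List.map_cons, List.map_nil, List.mem_cons,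
      List.not_mem_nil, or_false, not_or] at hnot
    have hn' : n < 56 := Finset.mem_range.1 hn
    interval_cases n
    · exact weilSemilocalCoeff_of_not_isPrimePow _ (by decide)
    · exact weilSemilocalCoeff_of_not_isPrimePow _ (by decide)
    · simp at hnot
    · simp at hnot
    · simp at hnot
    · simp at hnot
    · exact weilSemilocalCoeff_of_not_isPrimePow _ (by decide)
    · simp at hnot
    · simp at hnot
    · simp at hnot
    · exact weilSemilocalCoeff_of_not_isPrimePow _ (by decide)
    · simp at hnot
    · exact weilSemilocalCoeff_of_not_isPrimePow _ (by decide)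
    · simp at hnot
    · exact weilSemilocalCoeff_of_not_isPrimePow _ (by decide)
    · exact weilSemilocalCoeff_of_not_isPrimePow _ (not_isPrimePow_of_two_primes_dvd Nat.prime_three (by norm_num : Nat.Prime 5) (by norm_num) (by norm_num) (by norm_num))
    · simp at hnot
    · simp at hnot
    · exact weilSemilocalCoeff_of_not_isPrimePow _ (by decide)
    · simp at hnot
    · exact weilSemilocalCoeff_of_not_isPrimePow _ (by decide)
    · exact weilSemilocalCoeff_of_not_isPrimePow _ (not_isPrimePow_of_two_primes_dvd Nat.prime_three (by norm_num : Nat.Prime 7) (by norm_num) (by norm_num) (by norm_num))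
    · exact weilSemilocalCoeff_of_not_isPrimePow _ (by decide)
    · simp at hnot
    · exact weilSemilocalCoeff_of_not_isPrimePow _ (by decide)
    · simp at hnot
    · exact weilSemilocalCoeff_of_not_isPrimePow _ (by decide)
    · simp at hnot
    · exact weilSemilocalCoeff_of_not_isPrimePow _ (by decide)
    · simp at hnot
    · exact weilSemilocalCoeff_of_not_isPrimePow _ (by decide)
    · simp at hnot
    · simp at hnot
    · exact weilSemilocalCoeff_of_not_isPrimePow _ (not_isPrimePow_of_two_primes_dvd Nat.prime_three (by norm_num : Nat.Prime 11) (by norm_num) (by norm_num) (by norm_num))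
    · exact weilSemilocalCoeff_of_not_isPrimePow _ (by decide)
    · exact weilSemilocalCoeff_of_not_isPrimePow _ (not_isPrimePow_of_two_primes_dvd (by norm_num : Nat.Prime 5) (by norm_num : Nat.Prime 7) (by norm_num) (by norm_num) (by norm_num))
    · exact weilSemilocalCoeff_of_not_isPrimePow _ (by decide)
    · simp at hnot
    · exact weilSemilocalCoeff_of_not_isPrimePow _ (by decide)
    · exact weilSemilocalCoeff_of_not_isPrimePow _ (not_isPrimePow_of_two_primes_dvd Nat.prime_three (by norm_num : Nat.Prime 13) (by norm_num) (by norm_num) (by norm_num))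
    · exact weilSemilocalCoeff_of_not_isPrimePow _ (by decide)
    · simp at hnot
    · exact weilSemilocalCoeff_of_not_isPrimePow _ (by decide)
    · simp at hnot
    · exact weilSemilocalCoeff_of_not_isPrimePow _ (by decide)
    · exact weilSemilocalCoeff_of_not_isPrimePow _ (not_isPrimePow_of_two_primes_dvd Nat.prime_three (by norm_num : Nat.Prime 5) (by norm_num) (by norm_num) (by norm_num))
    · exact weilSemilocalCoeff_of_not_isPrimePow _ (by decide)
    · simp at hnot
    · exact weilSemilocalCoeff_of_not_isPrimePow _ (by decide)
    · simp at hnot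
    · exact weilSemilocalCoeff_of_not_isPrimePow _ (by decide)
    · exact weilSemilocalCoeff_of_not_isPrimePow _ (not_isPrimePow_of_two_primes_dvd Nat.prime_three (by norm_num : Nat.Prime 17) (by norm_num) (by norm_num) (by norm_num))
    · exact weilSemilocalCoeff_of_not_isPrimePow _ (by decide)
    · exact weilSemilocalCoeff_prime_of_not_mem (by norm_num) (by decide)
    · exact weilSemilocalCoeff_of_not_isPrimePow _ (by decide)
    · exact weilSemilocalCoeff_of_not_isPrimePow _ (not_isPrimePow_of_two_primes_dvd (by norm_num : Nat.Prime 5) (by norm_num : Nat.Prime 11) (by norm_num) (by norm_num) (by norm_num))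
  encl := by
    intro na hna
    simp only [atomsUptoFortySeven, List.mem_cons, List.not_mem_nil, or_false] at hna
    rcases hna with rfl | rfl | rfl | rfl | rfl | rfl | rfl | rfl | rfl | rfl | rfl | rfl | rfl | rfl | rfl | rfl | rfl | rfl | rfl | rfl | rfl | rfl | rfl
    · exact atomTwo_encl (by decide)
    · exact atomThree_encl (by decide)
    · exact atomFour_encl (by decide)
    · exact atomFive_encl (by decide)
    · exact atomSeven_encl (by decide)
    · exact atomEight_encl (by decide)
    · exact atomNine_encl (by decide)
    · exact atomEleven_encl (by decide)
    · exact atomThirteen_encl (by decide)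
    · exact atomSixteen_encl (by decide)
    · exact atomSeventeen_encl (by decide)
    · exact atomNineteen_encl (by decide)
    · exact atomTwentyThree_encl (by decide)
    · exact atomTwentyFive_encl (by decide)
    · exact atomTwentySeven_encl (by decide)
    · exact atomTwentyNine_encl (by decide)
    · exact atomThirtyOne_encl (by decide)
    · exact atomThirtyTwo_encl (by decide)
    · exact atomThirtySeven_encl (by decide)
    · exact atomFortyOne_encl (by decide)
    · exact atomFortyThree_encl (by decide)
    · exact atomFortySeven_encl (by decide)
    · exact atomFortyNine_encl (by decide)
  logSucc := by
    have h2 := logTwoLo20_le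
    have h7 := logSevenLo_le
    have h56 : Real.log (((55 : ℕ) : ℝ) + 1) = 3 * Real.log 2 + Real.log 7 := by
      rw [show ((55 : ℕ) : ℝ) + 1 = 2 ^ 3 * 7 by norm_num, Real.log_mul (by norm_num) (by norm_num), Real.log_pow]; push_cast; ring
    rw [h56, logSuccLoUptoFortySeven]; push_cast; linarith

/-! ### The certificates -/

/-- The degree-13 witness at `b = 257 / 128` (bottom vector of the odd Legendre section d = 13 at b = 257/128, rounded to 8 digits; exact-kappa finder value Re Q_S/‖G‖² = −2.8570·10⁻⁴ (form without the polar credit); kernel margin (rhs − lhs)/‖G‖² = 2.29e-4), in powers of `x`. -/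
def pUptoFortySeven : List ℚ :=
  [0, 208786598433 / 1028, 0, -17539435594506240 / 16974593, 0, 1958794187846392479744 / 1121154893057, 0, -89464696677710725487001600 / 74051159531521793, 0, 1918977443650491885472259768320 / 4891005035897482905857, 0, -19385177185536140507198771089637376 / 323045991615992848448948993, 0, 74463220233841479895132035490198323200 / 21336864700244711647204632038657]

/-- The piecewise certificate at `b = 257 / 128`: orders `(nA, mA, KA, Kt, nt, ne) = (10, 4, 5, 10, 40, 16)`, cuts `[1, 3 / 2, 19 / 10, 11 / 5, 5 / 2, 57 / 20, 16 / 5, 173 / 50, 37 / 10, 39 / 10, 257 / 64]`,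
claimed piece bounds and atom bound (exact rational values rounded up to integers). -/
def certUptoFortySeven : WeilNegCertP :=
  ⟨pUptoFortySeven, 257 / 128, 10, 4, 5, 10, 40, 16, atomsUptoFortySeven, logSuccLoUptoFortySeven,
   [1, 3 / 2, 19 / 10, 11 / 5, 5 / 2, 57 / 20, 16 / 5, 173 / 50, 37 / 10, 39 / 10, 257 / 64],
   [24517495591239121, 6681628657289074, 4394524755094917, 2101163376687163, 2284639531048033, 1943089645331231, 1001043209471639, 1004416308643863, 963623670145213, 652940202458062, 332146730766354], 244901074081931741⟩

set_option maxHeartbeats 0 in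
/-- kernel fact: side conditions and the final inequality of `certUptoFortySeven`. -/
theorem check_UptoFortySeven_main : certUptoFortySeven.checkMainW c0SharpQ = true := by
  decide +kernel

set_option maxHeartbeats 0 in
/-- kernel fact: the atom side of `certUptoFortySeven`. -/
theorem check_UptoFortySeven_atoms : certUptoFortySeven.checkAtoms = true := by
  decide +kernel

set_option maxHeartbeats 0 in
/-- kernel fact: piece `0` of `certUptoFortySeven`. -/
theorem check_UptoFortySeven_piece0 : certUptoFortySeven.checkPieceW 0 = true := by
  decide +kernel

set_option maxHeartbeats 0 in
/-- kernel fact: piece `1` of `certUptoFortySeven`. -/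
theorem check_UptoFortySeven_piece1 : certUptoFortySeven.checkPieceW 1 = true := by
  decide +kernel

set_option maxHeartbeats 0 in
/-- kernel fact: piece `2` of `certUptoFortySeven`. -/
theorem check_UptoFortySeven_piece2 : certUptoFortySeven.checkPieceW 2 = true := by
  decide +kernel

set_option maxHeartbeats 0 in
/-- kernel fact: piece `3` of `certUptoFortySeven`. -/
theorem check_UptoFortySeven_piece3 : certUptoFortySeven.checkPieceW 3 = true := by
  decide +kernel

set_option maxHeartbeats 0 in
/-- kernel fact: piece `4` of `certUptoFortySeven`. -/
theorem check_UptoFortySeven_piece4 : certUptoFortySeven.checkPieceW 4 = true := by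
  decide +kernel

set_option maxHeartbeats 0 in
/-- kernel fact: piece `5` of `certUptoFortySeven`. -/
theorem check_UptoFortySeven_piece5 : certUptoFortySeven.checkPieceW 5 = true := by
  decide +kernel

set_option maxHeartbeats 0 in
/-- kernel fact: piece `6` of `certUptoFortySeven`. -/
theorem check_UptoFortySeven_piece6 : certUptoFortySeven.checkPieceW 6 = true := by
  decide +kernel

set_option maxHeartbeats 0 in
/-- kernel fact: piece `7` of `certUptoFortySeven`. -/
theorem check_UptoFortySeven_piece7 : certUptoFortySeven.checkPieceW 7 = true := by
  decide +kernel

set_option maxHeartbeats 0 in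
/-- kernel fact: piece `8` of `certUptoFortySeven`. -/
theorem check_UptoFortySeven_piece8 : certUptoFortySeven.checkPieceW 8 = true := by
  decide +kernel

set_option maxHeartbeats 0 in
/-- kernel fact: piece `9` of `certUptoFortySeven`. -/
theorem check_UptoFortySeven_piece9 : certUptoFortySeven.checkPieceW 9 = true := by
  decide +kernel

set_option maxHeartbeats 0 in
/-- kernel fact: piece `10` of `certUptoFortySeven`. -/
theorem check_UptoFortySeven_piece10 : certUptoFortySeven.checkPieceW 10 = true := by
  decide +kernel

/-- all pieces of `certUptoFortySeven` check. -/
theorem check_UptoFortySeven_pieces : ∀ i, i < certUptoFortySeven.cuts.length → certUptoFortySeven.checkPieceW i = true := by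
  intro i hi
  have hi' : i < 11 := hi
  interval_cases i
  · exact check_UptoFortySeven_piece0
  · exact check_UptoFortySeven_piece1
  · exact check_UptoFortySeven_piece2
  · exact check_UptoFortySeven_piece3
  · exact check_UptoFortySeven_piece4
  · exact check_UptoFortySeven_piece5
  · exact check_UptoFortySeven_piece6
  · exact check_UptoFortySeven_piece7
  · exact check_UptoFortySeven_piece8
  · exact check_UptoFortySeven_piece9
  · exact check_UptoFortySeven_piece10

/-! ### The theorems -/

/-- **`a*({2,…,47}) ≤ 257/128`.** -/
theorem weilSemilocalThreshold_uptoFortySeven_le :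
    weilSemilocalThreshold {2, 3, 5, 7, 11, 13, 17, 19, 23, 29, 31, 37, 41, 43, 47} ≤ ((257 / 128 : ℚ) : ℝ) :=
  weilSemilocalThreshold_le_of_checkW_sharp certUptoFortySeven atomsEnclose_UptoFortySeven
    check_UptoFortySeven_main check_UptoFortySeven_atoms check_UptoFortySeven_pieces

/-- Failure form: positivity of the `{∞} ∪ S_53` form fails on every cone `C(B)`, `B > 257/128`. -/
theorem not_weilSemilocalPositivityOn_uptoFortySeven_of_gt {B : ℝ} (hB : (257 / 128 : ℝ) < B) :
    ¬ WeilSemilocalPositivityOn {2, 3, 5, 7, 11, 13, 17, 19, 23, 29, 31, 37, 41, 43, 47} B := by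
  rw [not_weilSemilocalPositivityOn_iff_weilSemilocalThreshold_lt]
  have h := weilSemilocalThreshold_uptoFortySeven_le
  push_cast at h
  linarith

/-- `a*({2,…,47}) < (log 56)/2`: below the window of the next index. -/
theorem weilSemilocalThreshold_uptoFortySeven_lt_log_fiftysix_half :
    weilSemilocalThreshold {2, 3, 5, 7, 11, 13, 17, 19, 23, 29, 31, 37, 41, 43, 47} < Real.log 56 / 2 := by
  have h := weilSemilocalThreshold_uptoFortySeven_le
  have e : Real.log 56 = 3 * Real.log 2 + Real.log 7 := by
    rw [show (56 : ℝ) = 2 ^ 3 * 7 by norm_num, Real.log_mul (by norm_num) (by norm_num), Real.log_pow]; push_cast; ring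
  have h2 := Literature.Analysis.SpecialFunctions.Real.log_two_gt_d20
  have h7 := log_seven_gt_d11
  push_cast at h
  rw [e]
  linarith

/-- **The class `2, …, 47 ∈ S ∌ 53`**: `a*(S) = a*({2,…,47})` (locality at `N = 55`). -/
theorem weilSemilocalThreshold_eq_uptoFortySeven {S : Finset ℕ} (h2 : 2 ∈ S) (h3 : 3 ∈ S) (h5 : 5 ∈ S) (h7 : 7 ∈ S) (h11 : 11 ∈ S) (h13 : 13 ∈ S) (h17 : 17 ∈ S) (h19 : 19 ∈ S) (h23 : 23 ∈ S) (h29 : 29 ∈ S) (h31 : 31 ∈ S) (h37 : 37 ∈ S) (h41 : 41 ∈ S) (h43 : 43 ∈ S) (h47 : 47 ∈ S)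
    (h53 : 53 ∉ S) : weilSemilocalThreshold S = weilSemilocalThreshold {2, 3, 5, 7, 11, 13, 17, 19, 23, 29, 31, 37, 41, 43, 47} := by
  refine weilSemilocalThreshold_congr (S := {2, 3, 5, 7, 11, 13, 17, 19, 23, 29, 31, 37, 41, 43, 47}) (S' := S) (N := 55) ?_ ?_
  · intro n hn hpp
    interval_cases n
    · exact absurd hpp (by decide)
    · exact absurd hpp (by decide)
    · rw [Nat.prime_two.primeFactors]; simp [h2]
    · rw [Nat.prime_three.primeFactors]; simp [h3]
    · rw [show (4 : ℕ) = 2 ^ 2 by norm_num, Nat.primeFactors_prime_pow two_ne_zero Nat.prime_two]; simp [h2]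
    · rw [(by norm_num : Nat.Prime 5).primeFactors]; simp [h5]
    · exact absurd hpp (by decide)
    · rw [(by norm_num : Nat.Prime 7).primeFactors]; simp [h7]
    · rw [show (8 : ℕ) = 2 ^ 3 by norm_num, Nat.primeFactors_prime_pow (by norm_num) Nat.prime_two]; simp [h2]
    · rw [show (9 : ℕ) = 3 ^ 2 by norm_num, Nat.primeFactors_prime_pow two_ne_zero Nat.prime_three]; simp [h3]
    · exact absurd hpp (by decide)
    · rw [(by norm_num : Nat.Prime 11).primeFactors]; simp [h11]
    · exact absurd hpp (by decide)
    · rw [(by norm_num : Nat.Prime 13).primeFactors]; simp [h13]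
    · exact absurd hpp (by decide)
    · exact absurd hpp (not_isPrimePow_of_two_primes_dvd Nat.prime_three (by norm_num : Nat.Prime 5) (by norm_num)
        (by norm_num) (by norm_num))
    · rw [show (16 : ℕ) = 2 ^ 4 by norm_num, Nat.primeFactors_prime_pow (by norm_num) Nat.prime_two]; simp [h2]
    · rw [(by norm_num : Nat.Prime 17).primeFactors]; simp [h17]
    · exact absurd hpp (by decide)
    · rw [(by norm_num : Nat.Prime 19).primeFactors]; simp [h19]
    · exact absurd hpp (by decide)
    · exact absurd hpp (not_isPrimePow_of_two_primes_dvd Nat.prime_three (by norm_num : Nat.Prime 7) (by norm_num)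
        (by norm_num) (by norm_num))
    · exact absurd hpp (by decide)
    · rw [(by norm_num : Nat.Prime 23).primeFactors]; simp [h23]
    · exact absurd hpp (by decide)
    · rw [show (25 : ℕ) = 5 ^ 2 by norm_num, Nat.primeFactors_prime_pow two_ne_zero (by norm_num : Nat.Prime 5)]; simp [h5]
    · exact absurd hpp (by decide)
    · rw [show (27 : ℕ) = 3 ^ 3 by norm_num, Nat.primeFactors_prime_pow (by norm_num) Nat.prime_three]; simp [h3]
    · exact absurd hpp (by decide)
    · rw [(by norm_num : Nat.Prime 29).primeFactors]; simp [h29]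
    · exact absurd hpp (by decide)
    · rw [(by norm_num : Nat.Prime 31).primeFactors]; simp [h31]
    · rw [show (32 : ℕ) = 2 ^ 5 by norm_num, Nat.primeFactors_prime_pow (by norm_num) Nat.prime_two]; simp [h2]
    · exact absurd hpp (not_isPrimePow_of_two_primes_dvd Nat.prime_three (by norm_num : Nat.Prime 11) (by norm_num)
        (by norm_num) (by norm_num))
    · exact absurd hpp (by decide)
    · exact absurd hpp (not_isPrimePow_of_two_primes_dvd (by norm_num : Nat.Prime 5) (by norm_num : Nat.Prime 7) (by norm_num)
        (by norm_num) (by norm_num))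
    · exact absurd hpp (by decide)
    · rw [(by norm_num : Nat.Prime 37).primeFactors]; simp [h37]
    · exact absurd hpp (by decide)
    · exact absurd hpp (not_isPrimePow_of_two_primes_dvd Nat.prime_three (by norm_num : Nat.Prime 13) (by norm_num)
        (by norm_num) (by norm_num))
    · exact absurd hpp (by decide)
    · rw [(by norm_num : Nat.Prime 41).primeFactors]; simp [h41]
    · exact absurd hpp (by decide)
    · rw [(by norm_num : Nat.Prime 43).primeFactors]; simp [h43]
    · exact absurd hpp (by decide)
    · exact absurd hpp (not_isPrimePow_of_two_primes_dvd Nat.prime_three (by norm_num : Nat.Prime 5) (by norm_num)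
        (by norm_num) (by norm_num))
    · exact absurd hpp (by decide)
    · rw [(by norm_num : Nat.Prime 47).primeFactors]; simp [h47]
    · exact absurd hpp (by decide)
    · rw [show (49 : ℕ) = 7 ^ 2 by norm_num, Nat.primeFactors_prime_pow two_ne_zero (by norm_num : Nat.Prime 7)]; simp [h7]
    · exact absurd hpp (by decide)
    · exact absurd hpp (not_isPrimePow_of_two_primes_dvd Nat.prime_three (by norm_num : Nat.Prime 17) (by norm_num)
        (by norm_num) (by norm_num))
    · exact absurd hpp (by decide)
    · rw [(by norm_num : Nat.Prime 53).primeFactors]; simp [h53]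
    · exact absurd hpp (by decide)
    · exact absurd hpp (not_isPrimePow_of_two_primes_dvd (by norm_num : Nat.Prime 5) (by norm_num : Nat.Prime 11) (by norm_num)
        (by norm_num) (by norm_num))
  · have h := weilSemilocalThreshold_uptoFortySeven_lt_log_fiftysix_half
    norm_num
    exact h

/-- **`a*(S) ≤ 257/128` for every finite set of primes `S` with `2, …, 47 ∈ S`, `53 ∉ S`.** -/
theorem weilSemilocalThreshold_le_of_mem_fortyseven {S : Finset ℕ} (h2 : 2 ∈ S) (h3 : 3 ∈ S) (h5 : 5 ∈ S) (h7 : 7 ∈ S) (h11 : 11 ∈ S) (h13 : 13 ∈ S) (h17 : 17 ∈ S) (h19 : 19 ∈ S) (h23 : 23 ∈ S) (h29 : 29 ∈ S) (h31 : 31 ∈ S) (h37 : 37 ∈ S) (h41 : 41 ∈ S) (h43 : 43 ∈ S) (h47 : 47 ∈ S)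
    (h53 : 53 ∉ S) : weilSemilocalThreshold S ≤ ((257 / 128 : ℚ) : ℝ) := by
  rw [weilSemilocalThreshold_eq_uptoFortySeven h2 h3 h5 h7 h11 h13 h17 h19 h23 h29 h31 h37 h41 h43 h47 h53]
  exact weilSemilocalThreshold_uptoFortySeven_le

/-- **The bracket of the class `2, …, 47 ∈ S ∌ 53`**: `4023/5000 ≤ a*(S) ≤ 257/128` (DATA `a*(S_53) ≈ 1.985188`). -/
theorem weilSemilocalThreshold_mem_Icc_of_mem_fortyseven {S : Finset ℕ} (h2 : 2 ∈ S) (h3 : 3 ∈ S) (h5 : 5 ∈ S) (h7 : 7 ∈ S) (h11 : 11 ∈ S) (h13 : 13 ∈ S) (h17 : 17 ∈ S) (h19 : 19 ∈ S) (h23 : 23 ∈ S) (h29 : 29 ∈ S) (h31 : 31 ∈ S) (h37 : 37 ∈ S) (h41 : 41 ∈ S) (h43 : 43 ∈ S) (h47 : 47 ∈ S)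
    (h53 : 53 ∉ S) : weilSemilocalThreshold S ∈ Set.Icc (4023 / 5000 : ℝ) ((257 / 128 : ℚ) : ℝ) :=
  ⟨SemilocalTwoThree.le_weilSemilocalThreshold_of_two_three_8046 h2 h3,
    weilSemilocalThreshold_le_of_mem_fortyseven h2 h3 h5 h7 h11 h13 h17 h19 h23 h29 h31 h37 h41 h43 h47 h53⟩

end Summit.RiemannHypothesis.RiemannHypothesis.Theorems.SemilocalPolyWitness

end

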